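import Summits.HodgeConjecture.HodgeConjecture.Theorems.WeilTypeLadderTargetTransfer
import Literature.AlgebraicGeometry.HodgeTheory.FermatHodgeConjectureProducts
import HarnessLib

/-!
# WeilTypeLadder · the rung R3 (`WeilClassesCMField`, CM fields of degree `> 2`) on target-dominated loci, and over a
# PAIR / TRIPLE of Fermat varieties of one degree (Shioda's product theorem as a NAMED FACT) — the bodies fed by
# PROPOSITION CYC′ (Fermat transfer for a CM SUBFIELD `K′ ⊊ ℚ(ζ_m)` of a cyclic-cover Prym)

b2b cell `hweil` (packet `run/shared/lean/b2b/hodge-weil/`, report `b2b-hweil-pv3-g43/CM-SUBFIELD-TRANSFER.md` §2–§4).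
Companion of `Theorems/WeilTypeLadderFermatTransferMulti` (R3 body, ONE Fermat target `Xᵏ_μ`, several maps) and of
`Theorems/WeilTypeLadderTargetTransferHigher` (R∞ / R2 bodies over Fermat PAIRS and TRIPLES).

Why a product target for R3. Let `B` be the `ζ_m`-primitive Prym of a connected `ℤ/m`-cover `C → ℙ¹` with `N = h + 2` branch
points, `E = ℚ(ζ_m)` acting through `s_B`, `H¹(B,ℂ) = ⊕_{n ∈ U} V_n` (`U = (ℤ/m)ˣ`, `dim V_n = h`). For a CM SUBFIELD
`K′ = E^{H′} ⊊ E` (`H′ ⊂ U` a subgroup with `-1 ∉ H′`, `s := |H′| = [E : K′]`) the space of `K′`-Weil classes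
(Moonen–Zarhin 1998 §1) is `W_{K′} ⊗ ℂ = ⊕_{c ∈ U/H′} ⋀^{hs}(⊕_{n ∈ cH′} V_n) = ⊕_c ⊗_{n ∈ cH′} ⋀ʰ V_n ⊂ H^{hs}(B, ℂ)`: each
`K′`-Weil line is a CUP PRODUCT of `s` partial cyclotomic lines `⋀ʰ V_n`. When the rotation tuple `β` is `K′`-Weil but NOT
`E`-Weil the factors `⋀ʰ V_n` are NOT Hodge classes (types `(D(n), h − D(n))` with `D(n) ≠ h/2`), only their products over
the cosets are — so the single-target transfer of PROPOSITION T_m (whose Fermat partners `V(nβ) ⊂ Hʰ(Xʰ_m)` have the same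
non-Hodge types) does not apply, but the transfer to the PRODUCT `(Xʰ_m)^s` does: the partner of `⊗_{n∈cH′} ⋀ʰ V_n` is
`⊠_{n ∈ cH′} V(u n β)` (`u ∈ U`), whose Galois orbit spans a rational sub-Hodge structure of `H^{hs}((Xʰ_m)^s, ℚ)` that
is pure of type `(hs/2, hs/2)` EXACTLY under the `K′`-Weil condition (PROPOSITION CYC′ of the report, pen-and-paper; the
imaginary-quadratic case `[K′:ℚ] = 2`, `s = φ(m)/2`, is PROPOSITION CYC of `b2b-hweil-pv3-g39/ORDERING-LEMMA.md` §3.2).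
For the quartic CM subfields of `ℚ(ζ₁₅)`, `ℚ(ζ₁₆)`, `ℚ(ζ₂₀)` one has `s = 2`: the target is a PAIR `X₁ ⊗ X₂` of Fermat
varieties `Xʰ_m`, `m ≤ 20`, and Shioda's Theorem 2 (`hodgeClasses_algebraic_fermatProduct₂`, refereed, typed in
`HodgeTheory/FermatHodgeConjectureProducts`) discharges the algebraicity of its rational `(p,p)`-classes. This file types
the R3-shaped bodies ONCE for all such loci:

* `weilClassesCMField_targetTransfer_of_facts` / `_of_weilClassesCMField` / `_of_hodgeConjecture` — the body of R3
  (`WeilClassesCMField`, rung binders VERBATIM FIRST), then a datum `(X', k, hX', hXH, T, a, ι, b)` with the target's rational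
  `(m′,m′)`-classes algebraic as the HYPOTHESIS `hXH`, then per class of `weilClassesField A φ P (2m′)` with
  `a^* c ∈ ⨆ᵢ (bᵢ)^*(span …)`: rational of type `(m′,m′)` ⇒ algebraic (binder `hP : fulton1998_map_mem_algebraicClasses`);
* `weilClassesCMField_fermatPairTransfer_…` — target `X₁ ⊗ X₂`, `Xᵢ = X^{nᵢ}_μ` smooth projective Fermat varieties of ONE
  degree `μ` (`μ` prime or `1 < μ ≤ 20`), any `n₁, n₂`; `hXH` discharged by `hodgeClasses_algebraic_fermatProduct₂`;
* `weilClassesCMField_fermatTripleTransfer_…` — target `(X₁ ⊗ X₂) ⊗ X₃`; `hXH` by `hodgeClasses_algebraic_fermatProduct₃`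
  (the sextic CM subfields `K′` with `[E:K′] = 3`, e.g. `ℚ(ζ₁₃)^{C₃}`-type data, are NOT placed in the report; typed for
  completeness of the `s ≤ 3` range).

HONEST LABEL: which abelian varieties carry the datum (PROPOSITION CYC′: the `ζ_m`-primitive Pryms of the `K′`-Weil
`ℤ/m`-covers of `ℙ¹`, pen-and-paper, ours) is NOT decided in the kernel; sub-families (curves in a Shimura variety of
`K′`-Weil type), never the general member; 0 unconditional rungs above the floor; conditional on [Shioda 1979 Thm. 2] +
[Fulton 1998 Cor. 19.2 (b)] (refereed) and on the datum; Markman-free; the standing `weilClassesField = W_{K′} ⊗ ℂ`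
identification flag of `Theorems/WeilTypeLadder.lean` applies. No `sorry`, no new definition, no new named fact.
-/

noncomputable section

-- every declaration of this problem lives in `Summit.HodgeConjecture.HodgeConjecture.…` (summit = sub-problem)
set_option linter.dupNamespace false

open CategoryTheory MonoidalCategory
open Literature.AlgebraicGeometry Literature.AlgebraicGeometry.Motives
open Literature.AlgebraicGeometry.HodgeTheory
open Literature.AlgebraicTopology.SingularHomology

namespace Summit.HodgeConjecture.HodgeConjecture.WeilTypeLadder

/-! ### §1 R3 (`WeilClassesCMField`) with a target datum -/

section Target

/-- **R3 on the target-dominated locus, from the fact.** The body of `WeilClassesCMField` (rung binders first and verbatim: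
`A, φ, P, e, m` with `P` monic irreducible of degree `e > 2`, `P(φ) = 0`, `e·(2m) = 2·dim A`, `K = ℚ(φ)` a CM field), then a
datum `(X', k, hX', hXH, T, a, ι, b)` — `X'` smooth projective of dimension `k` whose rational `(m,m)`-classes span algebraic
classes, `dim T = dim A`, `a : T ⟶ A.X` surjective, `b : ι → (T ⟶ X')` — then for every class of `weilClassesField A φ P (2m)`
with `a^* c ∈ ⨆ᵢ (bᵢ)^*(span of the rational (m,m)-classes of X')`: rational of type `(m,m)` ⇒ algebraic.
[cite: Fulton1998, §19.2 Cor. 19.2 (b)] [cite: MoonenZarhin1998WeilClasses, §1] [cite: Markman2025SurveySecant, §12] -/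
theorem weilClassesCMField_targetTransfer_of_facts (hP : fulton1998_map_mem_algebraicClasses) :
    ∀ (A : Motives.AbelianVariety ℂ) (φ : A ⟶ A) (P : Polynomial ℤ) (e m : ℕ),
      P.Monic → P.natDegree = e → 2 < e → Irreducible (P.map (Int.castRingHom ℚ)) →
      Polynomial.eval₂ (Int.castRingHom (CategoryTheory.End A)) (φ : CategoryTheory.End A) P = 0 →
      e * (2 * m) = 2 * A.dim →
      (∀ ρ : ℂ, Polynomial.eval₂ (Int.castRingHom ℂ) ρ P = 0 → starRingEnd ℂ ρ ≠ ρ) →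
      (∃ Q : Polynomial ℚ, ∀ ρ : ℂ, Polynomial.eval₂ (Int.castRingHom ℂ) ρ P = 0 →
          Polynomial.eval₂ (algebraMap ℚ ℂ) ρ Q = starRingEnd ℂ ρ) →
    ∀ (X T : Motives.SchemeOver ℂ) (k : ℕ), IsSmoothProjective k X →
      Submodule.span ℂ {x : complexBetti X (2 * m) | IsRationalClass x ∧ IsOfHodgeType k X (2 * m) m m x} ≤
        algebraicClasses X m →
      IsSmoothProjective A.dim T →
    ∀ (a : T ⟶ A.X), AlgebraicGeometry.Surjective a.left → ∀ (ι : Type) (b : ι → (T ⟶ X)),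
      ∀ c ∈ weilClassesField A φ P (2 * m),
        complexBetti.map a (2 * m) c ∈ (⨆ i, (Submodule.span ℂ
            {x : complexBetti X (2 * m) | IsRationalClass x ∧ IsOfHodgeType k X (2 * m) m m x}).map
              (complexBetti.map (b i) (2 * m)).hom) →
        IsRationalClass c → IsOfHodgeType A.dim A.X (2 * m) m m c → c ∈ algebraicClasses A.X m := by
  intro A φ P e m _ _ _ _ _ _ _ _ X T k hX hXH hT a ha ι b c _ hc _ _
  exact abelianVariety_mem_algebraicClasses_of_targetTransferFamily hP A hX hXH hT a b hc

/-- **The same body from the rung R3 itself** (`WeilClassesCMField`; the datum is not used): the target-dominated locus is a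
CASE of the rung. -/
theorem weilClassesCMField_targetTransfer_of_weilClassesCMField (h : WeilClassesCMField) :
    ∀ (A : Motives.AbelianVariety ℂ) (φ : A ⟶ A) (P : Polynomial ℤ) (e m : ℕ),
      P.Monic → P.natDegree = e → 2 < e → Irreducible (P.map (Int.castRingHom ℚ)) →
      Polynomial.eval₂ (Int.castRingHom (CategoryTheory.End A)) (φ : CategoryTheory.End A) P = 0 →
      e * (2 * m) = 2 * A.dim →
      (∀ ρ : ℂ, Polynomial.eval₂ (Int.castRingHom ℂ) ρ P = 0 → starRingEnd ℂ ρ ≠ ρ) →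
      (∃ Q : Polynomial ℚ, ∀ ρ : ℂ, Polynomial.eval₂ (Int.castRingHom ℂ) ρ P = 0 →
          Polynomial.eval₂ (algebraMap ℚ ℂ) ρ Q = starRingEnd ℂ ρ) →
    ∀ (X T : Motives.SchemeOver ℂ) (k : ℕ), IsSmoothProjective k X →
      Submodule.span ℂ {x : complexBetti X (2 * m) | IsRationalClass x ∧ IsOfHodgeType k X (2 * m) m m x} ≤
        algebraicClasses X m →
      IsSmoothProjective A.dim T →
    ∀ (a : T ⟶ A.X), AlgebraicGeometry.Surjective a.left → ∀ (ι : Type) (b : ι → (T ⟶ X)),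
      ∀ c ∈ weilClassesField A φ P (2 * m),
        complexBetti.map a (2 * m) c ∈ (⨆ i, (Submodule.span ℂ
            {x : complexBetti X (2 * m) | IsRationalClass x ∧ IsOfHodgeType k X (2 * m) m m x}).map
              (complexBetti.map (b i) (2 * m)).hom) →
        IsRationalClass c → IsOfHodgeType A.dim A.X (2 * m) m m c → c ∈ algebraicClasses A.X m := by
  intro A φ P e m hP1 hP2 hP3 hP4 hP5 hP6 hP7 hP8 _ _ _ _ _ _ _ _ _ _ c hcW _ hc hmm
  exact h A φ P e m hP1 hP2 hP3 hP4 hP5 hP6 hP7 hP8 c hcW hc hmm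

/-- **On-path lemma**: `HodgeConjecture → WeilClassesCMField →` R3 on the target-dominated locus. -/
theorem weilClassesCMField_targetTransfer_of_hodgeConjecture (h : _root_.HodgeConjecture) :
    ∀ (A : Motives.AbelianVariety ℂ) (φ : A ⟶ A) (P : Polynomial ℤ) (e m : ℕ),
      P.Monic → P.natDegree = e → 2 < e → Irreducible (P.map (Int.castRingHom ℚ)) →
      Polynomial.eval₂ (Int.castRingHom (CategoryTheory.End A)) (φ : CategoryTheory.End A) P = 0 →
      e * (2 * m) = 2 * A.dim →
      (∀ ρ : ℂ, Polynomial.eval₂ (Int.castRingHom ℂ) ρ P = 0 → starRingEnd ℂ ρ ≠ ρ) →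
      (∃ Q : Polynomial ℚ, ∀ ρ : ℂ, Polynomial.eval₂ (Int.castRingHom ℂ) ρ P = 0 →
          Polynomial.eval₂ (algebraMap ℚ ℂ) ρ Q = starRingEnd ℂ ρ) →
    ∀ (X T : Motives.SchemeOver ℂ) (k : ℕ), IsSmoothProjective k X →
      Submodule.span ℂ {x : complexBetti X (2 * m) | IsRationalClass x ∧ IsOfHodgeType k X (2 * m) m m x} ≤
        algebraicClasses X m →
      IsSmoothProjective A.dim T →
    ∀ (a : T ⟶ A.X), AlgebraicGeometry.Surjective a.left → ∀ (ι : Type) (b : ι → (T ⟶ X)),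
      ∀ c ∈ weilClassesField A φ P (2 * m),
        complexBetti.map a (2 * m) c ∈ (⨆ i, (Submodule.span ℂ
            {x : complexBetti X (2 * m) | IsRationalClass x ∧ IsOfHodgeType k X (2 * m) m m x}).map
              (complexBetti.map (b i) (2 * m)).hom) →
        IsRationalClass c → IsOfHodgeType A.dim A.X (2 * m) m m c → c ∈ algebraicClasses A.X m :=
  weilClassesCMField_targetTransfer_of_weilClassesCMField (weilClassesCMField_of_hodgeConjecture h)

end Target

/-! ### §2 R3 over a PAIR of Fermat varieties `X^{n₁}_μ ⊗ X^{n₂}_μ`, from the named facts -/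

section Pair

/-- **R3 on the `X^{n₁}_μ ⊗ X^{n₂}_μ`-dominated locus, from the facts** (`μ` prime or `1 < μ ≤ 20`; any `n₁, n₂`): the body of
`WeilClassesCMField` (rung binders first and verbatim), then the datum (`μ`, `n₁ n₂`, Fermat varieties `X₁, X₂` of degree `μ`,
`dim T = dim A`, `a` surjective, `b : ι → (T ⟶ X₁ ⊗ X₂)`), then the per-class conclusion. Intended instances (report §3): the
`ζ_m`-primitive Prym EIGHTFOLDS of the `K′`-Weil, non-`E`-Weil `ℤ/m`-covers of `ℙ¹` with four branch points, `m ∈ {15, 16, 20}`,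
`K′ ⊂ ℚ(ζ_m)` a quartic CM subfield (`[E:K′] = 2`): target `X²_m ⊗ X²_m`, classes of `H⁴(B)` (`2m = 4`), `bᵢ` indexed by the
ordered pairs of disjoint `2`-subsets of `{1,…,8}` per coset. [cite: Shioda1979PJA, §2 Thm. 2 (p. 112) with the list after Thm. 1]
[cite: Fulton1998, §19.2 Cor. 19.2 (b)] [cite: MoonenZarhin1998WeilClasses, §1] -/
theorem weilClassesCMField_fermatPairTransfer_of_facts
    (hF₂ : hodgeClasses_algebraic_fermatProduct₂) (hP : fulton1998_map_mem_algebraicClasses) :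
    ∀ (A : Motives.AbelianVariety ℂ) (φ : A ⟶ A) (P : Polynomial ℤ) (e m : ℕ),
      P.Monic → P.natDegree = e → 2 < e → Irreducible (P.map (Int.castRingHom ℚ)) →
      Polynomial.eval₂ (Int.castRingHom (CategoryTheory.End A)) (φ : CategoryTheory.End A) P = 0 →
      e * (2 * m) = 2 * A.dim →
      (∀ ρ : ℂ, Polynomial.eval₂ (Int.castRingHom ℂ) ρ P = 0 → starRingEnd ℂ ρ ≠ ρ) →
      (∃ Q : Polynomial ℚ, ∀ ρ : ℂ, Polynomial.eval₂ (Int.castRingHom ℂ) ρ P = 0 →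
          Polynomial.eval₂ (algebraMap ℚ ℂ) ρ Q = starRingEnd ℂ ρ) →
    ∀ (μ : ℕ), μ.Prime ∨ (1 < μ ∧ μ ≤ 20) → ∀ (n₁ n₂ : ℕ) (X₁ X₂ T : Motives.SchemeOver ℂ),
      IsFermatVariety n₁ μ X₁ → IsSmoothProjective n₁ X₁ → IsFermatVariety n₂ μ X₂ → IsSmoothProjective n₂ X₂ →
      IsSmoothProjective A.dim T →
    ∀ (a : T ⟶ A.X), AlgebraicGeometry.Surjective a.left → ∀ (ι : Type) (b : ι → (T ⟶ X₁ ⊗ X₂)),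
      ∀ c ∈ weilClassesField A φ P (2 * m),
        complexBetti.map a (2 * m) c ∈ (⨆ i, (Submodule.span ℂ
            {x : complexBetti (X₁ ⊗ X₂) (2 * m) |
              IsRationalClass x ∧ IsOfHodgeType (n₁ + n₂) (X₁ ⊗ X₂) (2 * m) m m x}).map
              (complexBetti.map (b i) (2 * m)).hom) →
        IsRationalClass c → IsOfHodgeType A.dim A.X (2 * m) m m c → c ∈ algebraicClasses A.X m := by
  intro A φ P e m _ _ _ _ _ _ _ _ μ hμ n₁ n₂ X₁ X₂ T hF₁' hX₁ hF₂' hX₂ hT a ha ι b c _ hc _ _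
  exact abelianVariety_mem_algebraicClasses_of_targetTransferFamily hP A (hX₁.tensor_holds hX₂)
    (span_rational_hodge_le_algebraicClasses_fermatProduct₂ hF₂ hμ hF₁' hX₁ hF₂' hX₂ m) hT a b hc

/-- **The same body from the rung R3 itself** (`WeilClassesCMField`; the datum is not used). -/
theorem weilClassesCMField_fermatPairTransfer_of_weilClassesCMField (h : WeilClassesCMField) :
    ∀ (A : Motives.AbelianVariety ℂ) (φ : A ⟶ A) (P : Polynomial ℤ) (e m : ℕ),
      P.Monic → P.natDegree = e → 2 < e → Irreducible (P.map (Int.castRingHom ℚ)) →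
      Polynomial.eval₂ (Int.castRingHom (CategoryTheory.End A)) (φ : CategoryTheory.End A) P = 0 →
      e * (2 * m) = 2 * A.dim →
      (∀ ρ : ℂ, Polynomial.eval₂ (Int.castRingHom ℂ) ρ P = 0 → starRingEnd ℂ ρ ≠ ρ) →
      (∃ Q : Polynomial ℚ, ∀ ρ : ℂ, Polynomial.eval₂ (Int.castRingHom ℂ) ρ P = 0 →
          Polynomial.eval₂ (algebraMap ℚ ℂ) ρ Q = starRingEnd ℂ ρ) →
    ∀ (μ : ℕ), μ.Prime ∨ (1 < μ ∧ μ ≤ 20) → ∀ (n₁ n₂ : ℕ) (X₁ X₂ T : Motives.SchemeOver ℂ),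
      IsFermatVariety n₁ μ X₁ → IsSmoothProjective n₁ X₁ → IsFermatVariety n₂ μ X₂ → IsSmoothProjective n₂ X₂ →
      IsSmoothProjective A.dim T →
    ∀ (a : T ⟶ A.X), AlgebraicGeometry.Surjective a.left → ∀ (ι : Type) (b : ι → (T ⟶ X₁ ⊗ X₂)),
      ∀ c ∈ weilClassesField A φ P (2 * m),
        complexBetti.map a (2 * m) c ∈ (⨆ i, (Submodule.span ℂ
            {x : complexBetti (X₁ ⊗ X₂) (2 * m) |
              IsRationalClass x ∧ IsOfHodgeType (n₁ + n₂) (X₁ ⊗ X₂) (2 * m) m m x}).map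
              (complexBetti.map (b i) (2 * m)).hom) →
        IsRationalClass c → IsOfHodgeType A.dim A.X (2 * m) m m c → c ∈ algebraicClasses A.X m := by
  intro A φ P e m hP1 hP2 hP3 hP4 hP5 hP6 hP7 hP8 _ _ _ _ _ _ _ _ _ _ _ _ _ _ _ _ c hcW _ hc hmm
  exact h A φ P e m hP1 hP2 hP3 hP4 hP5 hP6 hP7 hP8 c hcW hc hmm

/-- **On-path lemma**: `HodgeConjecture → WeilClassesCMField →` R3 on the Fermat-pair-dominated locus. -/
theorem weilClassesCMField_fermatPairTransfer_of_hodgeConjecture (h : _root_.HodgeConjecture) :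
    ∀ (A : Motives.AbelianVariety ℂ) (φ : A ⟶ A) (P : Polynomial ℤ) (e m : ℕ),
      P.Monic → P.natDegree = e → 2 < e → Irreducible (P.map (Int.castRingHom ℚ)) →
      Polynomial.eval₂ (Int.castRingHom (CategoryTheory.End A)) (φ : CategoryTheory.End A) P = 0 →
      e * (2 * m) = 2 * A.dim →
      (∀ ρ : ℂ, Polynomial.eval₂ (Int.castRingHom ℂ) ρ P = 0 → starRingEnd ℂ ρ ≠ ρ) →
      (∃ Q : Polynomial ℚ, ∀ ρ : ℂ, Polynomial.eval₂ (Int.castRingHom ℂ) ρ P = 0 →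
          Polynomial.eval₂ (algebraMap ℚ ℂ) ρ Q = starRingEnd ℂ ρ) →
    ∀ (μ : ℕ), μ.Prime ∨ (1 < μ ∧ μ ≤ 20) → ∀ (n₁ n₂ : ℕ) (X₁ X₂ T : Motives.SchemeOver ℂ),
      IsFermatVariety n₁ μ X₁ → IsSmoothProjective n₁ X₁ → IsFermatVariety n₂ μ X₂ → IsSmoothProjective n₂ X₂ →
      IsSmoothProjective A.dim T →
    ∀ (a : T ⟶ A.X), AlgebraicGeometry.Surjective a.left → ∀ (ι : Type) (b : ι → (T ⟶ X₁ ⊗ X₂)),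
      ∀ c ∈ weilClassesField A φ P (2 * m),
        complexBetti.map a (2 * m) c ∈ (⨆ i, (Submodule.span ℂ
            {x : complexBetti (X₁ ⊗ X₂) (2 * m) |
              IsRationalClass x ∧ IsOfHodgeType (n₁ + n₂) (X₁ ⊗ X₂) (2 * m) m m x}).map
              (complexBetti.map (b i) (2 * m)).hom) →
        IsRationalClass c → IsOfHodgeType A.dim A.X (2 * m) m m c → c ∈ algebraicClasses A.X m :=
  weilClassesCMField_fermatPairTransfer_of_weilClassesCMField (weilClassesCMField_of_hodgeConjecture h)

end Pair

/-! ### §3 R3 over a TRIPLE `(X^{n₁}_μ ⊗ X^{n₂}_μ) ⊗ X^{n₃}_μ`, from the named facts -/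

section Triple

/-- **R3 on the `(X^{n₁}_μ ⊗ X^{n₂}_μ) ⊗ X^{n₃}_μ`-dominated locus, from the facts** (`μ` prime or `1 < μ ≤ 20`; any
`n₁, n₂, n₃`): the body of `WeilClassesCMField`, then the datum, then the per-class conclusion. Intended instances: CM
subfields `K′ ⊂ ℚ(ζ_m)` with `[ℚ(ζ_m) : K′] = 3` (PROPOSITION CYC′ with `s = 3`; none placed in the report).
[cite: Shioda1979PJA, §2 Thm. 2 (p. 112) with the list after Thm. 1] [cite: Fulton1998, §19.2 Cor. 19.2 (b)]
[cite: MoonenZarhin1998WeilClasses, §1] -/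
theorem weilClassesCMField_fermatTripleTransfer_of_facts
    (hF₃ : hodgeClasses_algebraic_fermatProduct₃) (hP : fulton1998_map_mem_algebraicClasses) :
    ∀ (A : Motives.AbelianVariety ℂ) (φ : A ⟶ A) (P : Polynomial ℤ) (e m : ℕ),
      P.Monic → P.natDegree = e → 2 < e → Irreducible (P.map (Int.castRingHom ℚ)) →
      Polynomial.eval₂ (Int.castRingHom (CategoryTheory.End A)) (φ : CategoryTheory.End A) P = 0 →
      e * (2 * m) = 2 * A.dim →
      (∀ ρ : ℂ, Polynomial.eval₂ (Int.castRingHom ℂ) ρ P = 0 → starRingEnd ℂ ρ ≠ ρ) →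
      (∃ Q : Polynomial ℚ, ∀ ρ : ℂ, Polynomial.eval₂ (Int.castRingHom ℂ) ρ P = 0 →
          Polynomial.eval₂ (algebraMap ℚ ℂ) ρ Q = starRingEnd ℂ ρ) →
    ∀ (μ : ℕ), μ.Prime ∨ (1 < μ ∧ μ ≤ 20) → ∀ (n₁ n₂ n₃ : ℕ) (X₁ X₂ X₃ T : Motives.SchemeOver ℂ),
      IsFermatVariety n₁ μ X₁ → IsSmoothProjective n₁ X₁ → IsFermatVariety n₂ μ X₂ → IsSmoothProjective n₂ X₂ →
      IsFermatVariety n₃ μ X₃ → IsSmoothProjective n₃ X₃ →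
      IsSmoothProjective A.dim T →
    ∀ (a : T ⟶ A.X), AlgebraicGeometry.Surjective a.left → ∀ (ι : Type) (b : ι → (T ⟶ (X₁ ⊗ X₂) ⊗ X₃)),
      ∀ c ∈ weilClassesField A φ P (2 * m),
        complexBetti.map a (2 * m) c ∈ (⨆ i, (Submodule.span ℂ
            {x : complexBetti ((X₁ ⊗ X₂) ⊗ X₃) (2 * m) |
              IsRationalClass x ∧ IsOfHodgeType (n₁ + n₂ + n₃) ((X₁ ⊗ X₂) ⊗ X₃) (2 * m) m m x}).map
              (complexBetti.map (b i) (2 * m)).hom) →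
        IsRationalClass c → IsOfHodgeType A.dim A.X (2 * m) m m c → c ∈ algebraicClasses A.X m := by
  intro A φ P e m _ _ _ _ _ _ _ _ μ hμ n₁ n₂ n₃ X₁ X₂ X₃ T hF₁' hX₁ hF₂' hX₂ hF₃' hX₃ hT a ha ι b c _ hc _ _
  exact abelianVariety_mem_algebraicClasses_of_targetTransferFamily hP A ((hX₁.tensor_holds hX₂).tensor_holds hX₃)
    (span_rational_hodge_le_algebraicClasses_fermatProduct₃ hF₃ hμ hF₁' hX₁ hF₂' hX₂ hF₃' hX₃ m) hT a b hc

/-- **The same body from the rung R3 itself** (`WeilClassesCMField`; the datum is not used). -/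
theorem weilClassesCMField_fermatTripleTransfer_of_weilClassesCMField (h : WeilClassesCMField) :
    ∀ (A : Motives.AbelianVariety ℂ) (φ : A ⟶ A) (P : Polynomial ℤ) (e m : ℕ),
      P.Monic → P.natDegree = e → 2 < e → Irreducible (P.map (Int.castRingHom ℚ)) →
      Polynomial.eval₂ (Int.castRingHom (CategoryTheory.End A)) (φ : CategoryTheory.End A) P = 0 →
      e * (2 * m) = 2 * A.dim →
      (∀ ρ : ℂ, Polynomial.eval₂ (Int.castRingHom ℂ) ρ P = 0 → starRingEnd ℂ ρ ≠ ρ) →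
      (∃ Q : Polynomial ℚ, ∀ ρ : ℂ, Polynomial.eval₂ (Int.castRingHom ℂ) ρ P = 0 →
          Polynomial.eval₂ (algebraMap ℚ ℂ) ρ Q = starRingEnd ℂ ρ) →
    ∀ (μ : ℕ), μ.Prime ∨ (1 < μ ∧ μ ≤ 20) → ∀ (n₁ n₂ n₃ : ℕ) (X₁ X₂ X₃ T : Motives.SchemeOver ℂ),
      IsFermatVariety n₁ μ X₁ → IsSmoothProjective n₁ X₁ → IsFermatVariety n₂ μ X₂ → IsSmoothProjective n₂ X₂ →
      IsFermatVariety n₃ μ X₃ → IsSmoothProjective n₃ X₃ →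
      IsSmoothProjective A.dim T →
    ∀ (a : T ⟶ A.X), AlgebraicGeometry.Surjective a.left → ∀ (ι : Type) (b : ι → (T ⟶ (X₁ ⊗ X₂) ⊗ X₃)),
      ∀ c ∈ weilClassesField A φ P (2 * m),
        complexBetti.map a (2 * m) c ∈ (⨆ i, (Submodule.span ℂ
            {x : complexBetti ((X₁ ⊗ X₂) ⊗ X₃) (2 * m) |
              IsRationalClass x ∧ IsOfHodgeType (n₁ + n₂ + n₃) ((X₁ ⊗ X₂) ⊗ X₃) (2 * m) m m x}).map
              (complexBetti.map (b i) (2 * m)).hom) →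
        IsRationalClass c → IsOfHodgeType A.dim A.X (2 * m) m m c → c ∈ algebraicClasses A.X m := by
  intro A φ P e m hP1 hP2 hP3 hP4 hP5 hP6 hP7 hP8 _ _ _ _ _ _ _ _ _ _ _ _ _ _ _ _ _ _ _ _ c hcW _ hc hmm
  exact h A φ P e m hP1 hP2 hP3 hP4 hP5 hP6 hP7 hP8 c hcW hc hmm

/-- **On-path lemma**: `HodgeConjecture → WeilClassesCMField →` R3 on the Fermat-triple-dominated locus. -/
theorem weilClassesCMField_fermatTripleTransfer_of_hodgeConjecture (h : _root_.HodgeConjecture) :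
    ∀ (A : Motives.AbelianVariety ℂ) (φ : A ⟶ A) (P : Polynomial ℤ) (e m : ℕ),
      P.Monic → P.natDegree = e → 2 < e → Irreducible (P.map (Int.castRingHom ℚ)) →
      Polynomial.eval₂ (Int.castRingHom (CategoryTheory.End A)) (φ : CategoryTheory.End A) P = 0 →
      e * (2 * m) = 2 * A.dim →
      (∀ ρ : ℂ, Polynomial.eval₂ (Int.castRingHom ℂ) ρ P = 0 → starRingEnd ℂ ρ ≠ ρ) →
      (∃ Q : Polynomial ℚ, ∀ ρ : ℂ, Polynomial.eval₂ (Int.castRingHom ℂ) ρ P = 0 →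
          Polynomial.eval₂ (algebraMap ℚ ℂ) ρ Q = starRingEnd ℂ ρ) →
    ∀ (μ : ℕ), μ.Prime ∨ (1 < μ ∧ μ ≤ 20) → ∀ (n₁ n₂ n₃ : ℕ) (X₁ X₂ X₃ T : Motives.SchemeOver ℂ),
      IsFermatVariety n₁ μ X₁ → IsSmoothProjective n₁ X₁ → IsFermatVariety n₂ μ X₂ → IsSmoothProjective n₂ X₂ →
      IsFermatVariety n₃ μ X₃ → IsSmoothProjective n₃ X₃ →
      IsSmoothProjective A.dim T →
    ∀ (a : T ⟶ A.X), AlgebraicGeometry.Surjective a.left → ∀ (ι : Type) (b : ι → (T ⟶ (X₁ ⊗ X₂) ⊗ X₃)),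
      ∀ c ∈ weilClassesField A φ P (2 * m),
        complexBetti.map a (2 * m) c ∈ (⨆ i, (Submodule.span ℂ
            {x : complexBetti ((X₁ ⊗ X₂) ⊗ X₃) (2 * m) |
              IsRationalClass x ∧ IsOfHodgeType (n₁ + n₂ + n₃) ((X₁ ⊗ X₂) ⊗ X₃) (2 * m) m m x}).map
              (complexBetti.map (b i) (2 * m)).hom) →
        IsRationalClass c → IsOfHodgeType A.dim A.X (2 * m) m m c → c ∈ algebraicClasses A.X m :=
  weilClassesCMField_fermatTripleTransfer_of_weilClassesCMField (weilClassesCMField_of_hodgeConjecture h)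

end Triple

end Summit.HodgeConjecture.HodgeConjecture.WeilTypeLadder

end
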